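import Summits.Ventures.HodgeRepro2.T5SU11LegendreDerivativeSum

/-!
# Sonin–Pólya for the Legendre polynomials: `sin θ · P_n(cos θ)² ≤ P_n(0)² + 4 P_n′(0)²/((2n+1)² + 1)`

In the variable `θ`, `u(θ) = P_n(cos θ)` satisfies Legendre's equation in the form
**`sin θ · u″ + cos θ · u′ + n(n+1) sin θ · u = 0`** (`legTheta_ode`, from row 383's `legendre_ode` by the chain
rule). The Liouville transform `g = √(sin θ) · u` satisfies `g″ + Φ g = 0` with `Φ = (n + ½)² + 1/(4 sin² θ)`,
decreasing on `(0, π/2]`, so by Sonin–Pólya the energy `g² + g′²/Φ` is non-decreasing there. Written WITHOUT square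
roots, with `A = cos θ · u + 2 sin θ · u′` and `D = (2n+1)² sin² θ + 1`:

  **`E(θ) := sin θ · u² + sin θ · A²/D`  has  `E′ = 2 cos θ · A²/D²`**  (`hasDerivAt_soninE`, a polynomial identity
  modulo Legendre's equation and `cos² + sin² = 1`),

so `E` is monotone on `[0, π/2]` (`monotoneOn_soninE`) and, `E(π/2) = P_n(0)² + 4 P_n′(0)²/((2n+1)² + 1)` being
the value at the midpoint, the first term gives

  **`sin θ · P_n(cos θ)² ≤ P_n(0)² + 4 P_n′(0)²/((2n+1)² + 1)`** for `θ ∈ (0, π)`  (`sin_mul_sq_legP_cos_le`;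
  the half `[π/2, π)` by the parity `P_n(−x) = (−1)ⁿ P_n(x)`),

i.e. **`√(1 − x²) · P_n(x)² ≤ P_n(0)² + 4 P_n′(0)²/((2n+1)² + 1)`** on `(−1, 1)` (`sqrt_one_sub_sq_mul_sq_legP_le`):
the weighted polynomial `(1 − x²)^{1/4} P_n(x)` is largest near the centre. Row 460 evaluates the right side and
obtains Bernstein's inequality. Nothing is claimed about (N).

Blind lane: Mathlib + the HodgeRepro2 prefix only; no sorry; axioms ⊆ {propext, Classical.choice,
Quot.sound}.
-/

namespace Summit.Ventures.HodgeRepro2.T5SU11LegendreSoninPolya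

open Filter Topology
open Set (Icc Ioo Ioc)
open scoped Real
open T5SU11SphericalLegendreAll T5SU11LegendreIdentities T5SU11LegendreBound T5SU11LegendreDerivativeSum
  T5SU11SphericalLegendreLaplace

/-! ### Legendre's equation in the variable `θ` -/

/-- `u(θ) = P_n(cos θ)`. -/
noncomputable def legTheta (n : ℕ) (θ : ℝ) : ℝ := legP n (Real.cos θ)

/-- `u′(θ) = −sin θ · P_n′(cos θ)`. -/
noncomputable def legTheta' (n : ℕ) (θ : ℝ) : ℝ := -Real.sin θ * legQ n (Real.cos θ)

/-- `u″(θ) = −cos θ · P_n′(cos θ) + sin² θ · P_n″(cos θ)`. -/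
noncomputable def legTheta'' (n : ℕ) (θ : ℝ) : ℝ :=
  -Real.cos θ * legQ n (Real.cos θ) + Real.sin θ ^ 2 * legR n (Real.cos θ)

/-- `u′` is the derivative of `u`. -/
theorem hasDerivAt_legTheta (n : ℕ) (θ : ℝ) : HasDerivAt (legTheta n) (legTheta' n θ) θ := by
  have h := (hasDerivAt_legP n (Real.cos θ)).comp θ (Real.hasDerivAt_cos θ)
  refine h.congr_deriv ?_
  unfold legTheta'
  ring

/-- `u″` is the derivative of `u′`. -/
theorem hasDerivAt_legTheta' (n : ℕ) (θ : ℝ) : HasDerivAt (legTheta' n) (legTheta'' n θ) θ := by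
  have h := ((Real.hasDerivAt_sin θ).neg.mul ((hasDerivAt_legQ n (Real.cos θ)).comp θ (Real.hasDerivAt_cos θ)))
  show HasDerivAt (fun θ => -Real.sin θ * legQ n (Real.cos θ)) _ θ
  refine h.congr_deriv ?_
  unfold legTheta''
  simp only [Function.comp_apply, Pi.neg_apply]
  ring

/-- **Legendre's equation in `θ`**: `sin θ · u″ + cos θ · u′ + n(n+1) sin θ · u = 0` (for every `θ`). -/
theorem legTheta_ode (n : ℕ) (θ : ℝ) :
    Real.sin θ * legTheta'' n θ + Real.cos θ * legTheta' n θ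
      + (n : ℝ) * ((n : ℝ) + 1) * Real.sin θ * legTheta n θ = 0 := by
  unfold legTheta'' legTheta' legTheta
  have h := legendre_ode n (Real.cos θ)
  have hcs : Real.cos θ ^ 2 - 1 = -Real.sin θ ^ 2 := by
    have := Real.cos_sq_add_sin_sq θ
    linarith
  rw [hcs] at h
  linear_combination (-Real.sin θ) * h

/-! ### The Sonin–Pólya energy -/

/-- `A = cos θ · u + 2 sin θ · u′`. -/
noncomputable def soninA (n : ℕ) (θ : ℝ) : ℝ := Real.cos θ * legTheta n θ + 2 * Real.sin θ * legTheta' n θ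

/-- `D = (2n+1)² sin² θ + 1 > 0`. -/
noncomputable def soninD (n : ℕ) (θ : ℝ) : ℝ := (2 * (n : ℝ) + 1) ^ 2 * Real.sin θ ^ 2 + 1

/-- **The energy** `E = sin θ · u² + sin θ · A²/D`. -/
noncomputable def soninE (n : ℕ) (θ : ℝ) : ℝ :=
  Real.sin θ * legTheta n θ ^ 2 + Real.sin θ * soninA n θ ^ 2 / soninD n θ

/-- `D > 0`. -/
theorem soninD_pos (n : ℕ) (θ : ℝ) : 0 < soninD n θ := by
  unfold soninD
  positivity

/-- `A′ = cos θ · u′ − (2n² + 2n + 1) sin θ · u` (Legendre's equation substituted). -/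
theorem hasDerivAt_soninA (n : ℕ) (θ : ℝ) :
    HasDerivAt (soninA n)
      (Real.cos θ * legTheta' n θ - (2 * (n : ℝ) ^ 2 + 2 * (n : ℝ) + 1) * Real.sin θ * legTheta n θ) θ := by
  have h := ((Real.hasDerivAt_cos θ).mul (hasDerivAt_legTheta n θ)).add
    (((Real.hasDerivAt_sin θ).const_mul 2).mul (hasDerivAt_legTheta' n θ))
  show HasDerivAt (fun θ => Real.cos θ * legTheta n θ + 2 * Real.sin θ * legTheta' n θ) _ θ
  refine h.congr_deriv ?_
  have e := legTheta_ode n θ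
  linear_combination (2 : ℝ) * e

/-- `D′ = 2 (2n+1)² sin θ cos θ`. -/
theorem hasDerivAt_soninD (n : ℕ) (θ : ℝ) :
    HasDerivAt (soninD n) (2 * (2 * (n : ℝ) + 1) ^ 2 * Real.sin θ * Real.cos θ) θ := by
  have h := (((Real.hasDerivAt_sin θ).pow 2).const_mul ((2 * (n : ℝ) + 1) ^ 2)).add_const 1
  show HasDerivAt (fun θ => (2 * (n : ℝ) + 1) ^ 2 * Real.sin θ ^ 2 + 1) _ θ
  refine h.congr_deriv ?_
  ring

/-- **Sonin–Pólya**: `E′ = 2 cos θ · A²/D²` — a polynomial identity modulo Legendre's equation and `cos² + sin² = 1`. -/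
theorem hasDerivAt_soninE (n : ℕ) (θ : ℝ) :
    HasDerivAt (soninE n) (2 * Real.cos θ * soninA n θ ^ 2 / soninD n θ ^ 2) θ := by
  have hD : soninD n θ ≠ 0 := (soninD_pos n θ).ne'
  have h1 := (Real.hasDerivAt_sin θ).mul ((hasDerivAt_legTheta n θ).pow 2)
  have h2 := ((Real.hasDerivAt_sin θ).mul ((hasDerivAt_soninA n θ).pow 2)).div (hasDerivAt_soninD n θ) hD
  have h := h1.add h2
  show HasDerivAt (fun θ => Real.sin θ * legTheta n θ ^ 2 + Real.sin θ * soninA n θ ^ 2 / soninD n θ) _ θ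
  refine h.congr_deriv ?_
  have hcs : Real.cos θ ^ 2 + Real.sin θ ^ 2 = 1 := Real.cos_sq_add_sin_sq θ
  have hD' : (2 * (n : ℝ) + 1) ^ 2 * Real.sin θ ^ 2 + 1 ≠ 0 := by positivity
  simp only [Pi.pow_apply, Pi.mul_apply]
  unfold soninA soninD
  field_simp
  linear_combination (-(legTheta n θ * (Real.cos θ * legTheta n θ + 2 * Real.sin θ * legTheta' n θ)
    * ((2 * (n : ℝ) + 1) ^ 2 * Real.sin θ ^ 2 + 1))) * hcs


/-! ### Monotonicity on `[0, π/2]` and the value at `π/2` -/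

/-- `E` is differentiable. -/
theorem differentiable_soninE (n : ℕ) : Differentiable ℝ (soninE n) :=
  fun θ => (hasDerivAt_soninE n θ).differentiableAt

/-- **`E` is monotone on `[0, π/2]`**: `E′ = 2 cos θ · A²/D² ≥ 0` there. -/
theorem monotoneOn_soninE (n : ℕ) : MonotoneOn (soninE n) (Icc 0 (π / 2)) := by
  refine monotoneOn_of_deriv_nonneg (convex_Icc 0 (π / 2)) (differentiable_soninE n).continuous.continuousOn
    (differentiable_soninE n).differentiableOn ?_
  intro θ hθ
  rw [interior_Icc] at hθ
  rw [(hasDerivAt_soninE n θ).deriv]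
  have hc : 0 ≤ Real.cos θ := Real.cos_nonneg_of_mem_Icc ⟨by linarith [hθ.1, Real.pi_pos], hθ.2.le⟩
  have hD := soninD_pos n θ
  positivity

/-- **The value at the midpoint**: `E(π/2) = P_n(0)² + 4 P_n′(0)²/((2n+1)² + 1)`. -/
theorem soninE_pi_div_two (n : ℕ) :
    soninE n (π / 2) = legP n 0 ^ 2 + 4 * legQ n 0 ^ 2 / ((2 * (n : ℝ) + 1) ^ 2 + 1) := by
  unfold soninE soninA soninD legTheta legTheta'
  rw [Real.sin_pi_div_two, Real.cos_pi_div_two]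
  ring

/-- **The Sonin–Pólya bound on `(0, π/2]`**: `sin θ · P_n(cos θ)² ≤ P_n(0)² + 4 P_n′(0)²/((2n+1)² + 1)`. -/
theorem sin_mul_sq_legP_cos_le_of_le_pi_div_two (n : ℕ) {θ : ℝ} (h0 : 0 < θ) (hπ : θ ≤ π / 2) :
    Real.sin θ * legP n (Real.cos θ) ^ 2 ≤ legP n 0 ^ 2 + 4 * legQ n 0 ^ 2 / ((2 * (n : ℝ) + 1) ^ 2 + 1) := by
  have hs : 0 ≤ Real.sin θ := Real.sin_nonneg_of_nonneg_of_le_pi h0.le (by linarith [Real.pi_pos])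
  have h1 : Real.sin θ * legP n (Real.cos θ) ^ 2 ≤ soninE n θ := by
    unfold soninE legTheta
    have hD := soninD_pos n θ
    have : 0 ≤ Real.sin θ * soninA n θ ^ 2 / soninD n θ := by positivity
    linarith
  have h2 : soninE n θ ≤ soninE n (π / 2) :=
    monotoneOn_soninE n ⟨h0.le, hπ⟩ ⟨by linarith [Real.pi_pos], le_rfl⟩ hπ
  rw [soninE_pi_div_two] at h2
  linarith

/-- **THE SONIN–PÓLYA BOUND**: `sin θ · P_n(cos θ)² ≤ P_n(0)² + 4 P_n′(0)²/((2n+1)² + 1)` for `θ ∈ (0, π)`. -/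
theorem sin_mul_sq_legP_cos_le (n : ℕ) {θ : ℝ} (h0 : 0 < θ) (hπ : θ < π) :
    Real.sin θ * legP n (Real.cos θ) ^ 2 ≤ legP n 0 ^ 2 + 4 * legQ n 0 ^ 2 / ((2 * (n : ℝ) + 1) ^ 2 + 1) := by
  rcases le_or_gt θ (π / 2) with h | h
  · exact sin_mul_sq_legP_cos_le_of_le_pi_div_two n h0 h
  · -- reflect: `θ′ = π − θ ∈ (0, π/2)`
    have h' := sin_mul_sq_legP_cos_le_of_le_pi_div_two n (θ := π - θ) (by linarith) (by linarith)
    rw [Real.sin_pi_sub, Real.cos_pi_sub, legP_neg, mul_pow, ← pow_mul, mul_comm n 2, pow_mul] at h'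
    simpa only [neg_one_sq, one_pow, one_mul] using h'

/-- **In the variable `x`**: `√(1 − x²) · P_n(x)² ≤ P_n(0)² + 4 P_n′(0)²/((2n+1)² + 1)` on `(−1, 1)`. -/
theorem sqrt_one_sub_sq_mul_sq_legP_le (n : ℕ) {x : ℝ} (hx1 : -1 < x) (hx2 : x < 1) :
    Real.sqrt (1 - x ^ 2) * legP n x ^ 2 ≤ legP n 0 ^ 2 + 4 * legQ n 0 ^ 2 / ((2 * (n : ℝ) + 1) ^ 2 + 1) := by
  have h := sin_mul_sq_legP_cos_le n (θ := Real.arccos x) (Real.arccos_pos.mpr hx2) (Real.arccos_lt_pi.mpr hx1)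
  rwa [Real.sin_arccos, Real.cos_arccos hx1.le hx2.le] at h

end Summit.Ventures.HodgeRepro2.T5SU11LegendreSoninPolya
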